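import Mathlib.Analysis.Matrix.Hermitian
import Literature.MathematicalPhysics.QuantumChemistry.CompactedThreeIndexOperatorBounds
import HarnessLib

/-!
# Hermiticity of the three-index maps, and the `T1` operator constant `9N + 6` on the DQG set ALONE

Topic `Literature/MathematicalPhysics/QuantumChemistry`; continuation of `T1OperatorBound.lean`
(`IsDQGFeasible.re_quadForm_t1Map_le`: `Re x* T1 x ≤ (9N+6) ‖x‖²` on the DQG-feasible set, and the
Löwner form `(9N+6) · 1 − T1 ⪰ 0` on the `PQGT1` rung) and of `CompactedThreeIndexOperatorBounds.lean`
(the orbit-compression rule, `((9N+6)/6) · 1 − T1[e₀,e₀] ⪰ 0` on sorted triples, `PQGT1` rung).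
HONEST FRAMING (cell chem-oracle, LADDER-CHEM I-TYPE slot 08): statements about a finite model
Hamiltonian's reduced density matrices and their semidefinite relaxations; this file certifies no number.

WHY THIS FILE. The a-priori operator constants `x̄` of the neg-split / eigen-count a-posteriori bound
(`SemidefiniteRigorousBoundsNegSplit.lean`, `Jansson2007.corollary_6_1a_feasible`) must hold on the
RELAXED feasible set of the semidefinite program AS STATED. The `T1` Löwner bound of
`T1OperatorBound.lean` is stated on `IsDQGT1Feasible` (full `T1 ⪰ 0`), where the hypothesis `T1 ⪰ 0` is
used ONLY to know that `t1Map γ Γ` is Hermitian. A RESTRICTED three-index program (`DQG + T1[e₁] +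
T2[e₂] + T2′[e₃]`, `RestrictedThreeIndexFeasible.lean`; the rung of the cell's transition-metal rows)
does not contain `T1 ⪰ 0`. Here the Hermiticity is proved from that of `γ` and `Γ` — Nakata et al.
(2008) §III list it among the conditions imposed: "(1) Hermiticity of the matrices `γ`, `Γ`, `Q`, `G`,
`T1`, `T2`, and `T2′`" [corpus `paper:doi-10-1063-1-2911696` p0006 L44] — so that the whole `T1`
family holds on `IsDQGFeasible` alone, hence for every sub-block or compacted block of `T1` in ANY
program containing the `D`, `Q`, `G` conditions, with no hypothesis on the block.
[cite: NakataEtAl2008, §III item (1), p. 164113-5]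

WHAT IS PROVED (0 sorry, no definition, no named fact):
* §1 `t1Map_isHermitian`, `t2Map_isHermitian`, `t2PrimeMap_isHermitian` (from `γ`, `Γ` Hermitian: the
  printed formulas of Nakata et al. (2008) §II.A–B are symmetric under exchanging the row and column
  triples and conjugating; for `T2′ = ( T2 X ; X⁺ γ )` "`X⁺` is, of course, the Hermitian adjoint of
  `X`", Braams–Percus–Zhao (2007) §II eq. (4) [corpus `book:editornd-reduced-density-matrix-mechanics`
  p0106 L7]); `IsDQGFeasible.t1Map_isHermitian` / `…t2Map…` / `…t2PrimeMap…`;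
* §2 `IsDQGFeasible.posSemidef_smul_one_sub_t1Map`: `(9N+6) · 1 − t1Map γ Γ ⪰ 0` on the DQG set;
  `…_submatrix` (any injective member list `e`: `(9N+6) · 1 − T1[e,e] ⪰ 0`);
  `…_sixth_smul_one_sub_t1Map_submatrix` / `…_orderedTriples` (`(9N+6)/6` on orbit representatives,
  e.g. the sorted triples, or one spin class `(xσ < yσ, zτ)` of them);
* §3 the `ℝ`-programme shapes `…_re`.
Scale (printed trace constant `(r−2)(r(r−1)−3N(r−N))`, Chaykin et al. (2016) (4.6) [fetched
`optimization-online 5730.pdf` = corpus `paper:url-8a9601dd32ed` p0015 L33–42]): `r = 32`, `N = 16`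
(a `(16e,16o)` model): `150` full / `25` compacted, on the DQG set. [cite: ChaykinEtAl2016RigorousESC, §4.1 eq. (4.6), p. 15]
-/

noncomputable section

namespace Literature.MathematicalPhysics.QuantumChemistry

open Matrix Finset Literature.MathematicalPhysics.QuantumLattice
open scoped ComplexOrder

/-! ### §1 Hermiticity of `T1`, `T2`, `T2′` from that of `γ`, `Γ` -/

section Hermitian

variable {ι : Type*} [LinearOrder ι] {γ : Matrix ι ι ℂ} {Γ : Matrix (ι × ι) (ι × ι) ℂ}

/-- The conjugate of a Kronecker delta is the transposed delta (plumbing). [folklore] -/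
private theorem star_delta (a b : ι) :
    star (if a = b then (1 : ℂ) else 0) = if b = a then (1 : ℂ) else 0 := by
  by_cases h : a = b
  · simp [h]
  · simp [h, Ne.symm h]

/-- **`T1` is Hermitian whenever `γ` and `Γ` are**: the 33-term formula of Nakata et al. (2008) §II.A
(`t1Map_apply`) goes into itself under `(ijk) ↔ (lmn)` and complex conjugation. Nakata et al. impose
"(1) Hermiticity of the matrices `γ`, `Γ`, `Q`, `G`, `T1`, `T2`, and `T2′`".
[cite: NakataEtAl2008, §III item (1), p. 164113-5] -/
theorem t1Map_isHermitian (hγ : γ.IsHermitian) (hΓ : Γ.IsHermitian) : (t1Map γ Γ).IsHermitian := by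
  refine Matrix.IsHermitian.ext fun I J => ?_
  obtain ⟨i, j, k⟩ := I
  obtain ⟨l, m, n⟩ := J
  have hG : ∀ p q : ι × ι, star (Γ p q) = Γ q p := fun p q => hΓ.apply q p
  have hg : ∀ a b : ι, star (γ a b) = γ b a := fun a b => hγ.apply b a
  rw [t1Map_apply, t1Map_apply]
  simp only [star_add, star_sub, star_mul', hG, hg, star_delta]
  ring

/-- **`T2` is Hermitian whenever `γ` and `Γ` are** (the 7-term formula of Nakata et al. (2008) §II.A,
`t2Map_apply`). [cite: NakataEtAl2008, §III item (1), p. 164113-5] -/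
theorem t2Map_isHermitian (hγ : γ.IsHermitian) (hΓ : Γ.IsHermitian) : (t2Map γ Γ).IsHermitian := by
  refine Matrix.IsHermitian.ext fun I J => ?_
  obtain ⟨i, j, k⟩ := I
  obtain ⟨l, m, n⟩ := J
  have hG : ∀ p q : ι × ι, star (Γ p q) = Γ q p := fun p q => hΓ.apply q p
  have hg : ∀ a b : ι, star (γ a b) = γ b a := fun a b => hγ.apply b a
  rw [t2Map_apply, t2Map_apply]
  simp only [star_add, star_sub, star_mul', hG, hg, star_delta]
  ring

/-- **`T2′ = ( T2 X ; X⁺ γ )` is Hermitian whenever `γ` and `Γ` are** ("`X⁺` is, of course, the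
Hermitian adjoint of `X`", Braams–Percus–Zhao (2007) §II eq. (4); `t2PrimeMap`).
[cite: BraamsPercusZhao2007, §II eq. (4)] -/
theorem t2PrimeMap_isHermitian (hγ : γ.IsHermitian) (hΓ : Γ.IsHermitian) :
    (t2PrimeMap γ Γ).IsHermitian := by
  have hG : ∀ p q : ι × ι, star (Γ p q) = Γ q p := fun p q => hΓ.apply q p
  unfold t2PrimeMap
  refine Matrix.IsHermitian.fromBlocks (t2Map_isHermitian hγ hΓ) ?_ hγ
  ext a I
  simp only [conjTranspose_apply, Matrix.of_apply, hG]

end Hermitian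

section DQG

variable {ι : Type*} [LinearOrder ι] [Fintype ι] {N : ℕ} {γ : Matrix ι ι ℂ}
  {Γ : Matrix (ι × ι) (ι × ι) ℂ}

/-- On the DQG-feasible set `T1` is Hermitian (`γ` Hermitian, `Γ ⪰ 0`). [cite: NakataEtAl2008, §III item (1), p. 164113-5] -/
theorem IsDQGFeasible.t1Map_isHermitian (h : IsDQGFeasible N γ Γ) : (t1Map γ Γ).IsHermitian :=
  QuantumChemistry.t1Map_isHermitian h.herm_one h.d_psd.isHermitian

/-- On the DQG-feasible set `T2` is Hermitian. [cite: NakataEtAl2008, §III item (1), p. 164113-5] -/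
theorem IsDQGFeasible.t2Map_isHermitian (h : IsDQGFeasible N γ Γ) : (t2Map γ Γ).IsHermitian :=
  QuantumChemistry.t2Map_isHermitian h.herm_one h.d_psd.isHermitian

/-- On the DQG-feasible set `T2′` is Hermitian. [cite: NakataEtAl2008, §III item (1), p. 164113-5] -/
theorem IsDQGFeasible.t2PrimeMap_isHermitian (h : IsDQGFeasible N γ Γ) :
    (t2PrimeMap γ Γ).IsHermitian :=
  QuantumChemistry.t2PrimeMap_isHermitian h.herm_one h.d_psd.isHermitian

end DQG

/-! ### §2 `(9N+6) · 1 − T1 ⪰ 0` on the DQG set alone, and its sub-block / compacted forms -/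

section Loewner

/-- `u* · u = Σ_p ‖u_p‖²` (as a complex number; plumbing). [folklore] -/
private theorem star_dotProduct_self_eq_ofReal_sum₃ {m : Type*} [Fintype m] (u : m → ℂ) :
    star u ⬝ᵥ u = ((∑ p, ‖u p‖ ^ 2 : ℝ) : ℂ) := by
  rw [dotProduct, Complex.ofReal_sum]
  refine Finset.sum_congr rfl fun p _ => ?_
  rw [Pi.star_apply, Complex.star_def, Complex.conj_mul', Complex.ofReal_pow]

/-- **From a quadratic-form bound to a Löwner bound.** If `A` is Hermitian and
`Re (x* A x) ≤ c ‖x‖²` for all `x`, then `c · 1 − A ⪰ 0`: "`A` is Hermitian if and only if …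
(a) `x*Ax` is real for all `x ∈ ℂⁿ`" (Horn–Johnson Thm 4.1.4 [corpus `book:horn2012-matrix-analysis`
chunk p0294 L7–L9]), so `x* (c · 1 − A) x = c ‖x‖² − x*Ax` is real and nonnegative. Packaging of the
cited fact for the Löwner-form operator constants of this topic. [cite: HornJohnson2013, Thm 4.1.4 (a)] -/
theorem posSemidef_smul_one_sub_of_re_quadForm_le {m : Type*} [Fintype m] [DecidableEq m]
    {A : Matrix m m ℂ} (hA : A.IsHermitian) {c : ℝ}
    (h : ∀ x : m → ℂ, (star x ⬝ᵥ (A *ᵥ x)).re ≤ c * ∑ j, ‖x j‖ ^ 2) :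
    ((c : ℂ) • (1 : Matrix m m ℂ) - A).PosSemidef := by
  have hherm : ((c : ℂ) • (1 : Matrix m m ℂ) - A).IsHermitian := by
    have h1 : ((c : ℂ) • (1 : Matrix m m ℂ)).IsHermitian := by
      rw [IsHermitian, conjTranspose_smul, conjTranspose_one, Complex.star_def, Complex.conj_ofReal]
    exact h1.sub hA
  refine PosSemidef.of_dotProduct_mulVec_nonneg hherm fun x => ?_
  have him : (star x ⬝ᵥ (A *ᵥ x)).im = 0 := by
    simpa using hA.im_star_dotProduct_mulVec_self x
  rw [sub_mulVec, smul_mulVec, one_mulVec, dotProduct_sub, dotProduct_smul, smul_eq_mul,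
    star_dotProduct_self_eq_ofReal_sum₃, ← Complex.ofReal_mul, Complex.nonneg_iff, Complex.sub_re,
    Complex.ofReal_re, Complex.sub_im, Complex.ofReal_im, him, sub_zero]
  exact ⟨by linarith [h x], rfl⟩

/-- Re-indexing a Löwner bound along an injective map (plumbing). [folklore] -/
private theorem submatrix_smul_one_sub₃ {m l : Type*} [DecidableEq m] [DecidableEq l] (c : ℂ)
    (A : Matrix m m ℂ) {e : l → m} (he : Function.Injective e) :
    (c • (1 : Matrix m m ℂ) - A).submatrix e e = c • (1 : Matrix l l ℂ) - A.submatrix e e := by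
  ext i j
  simp only [submatrix_apply, Matrix.sub_apply, Matrix.smul_apply, Matrix.one_apply, he.eq_iff]

variable {ι : Type*} [LinearOrder ι] [Fintype ι] {N : ℕ} {γ : Matrix ι ι ℂ}
  {Γ : Matrix (ι × ι) (ι × ι) ℂ}

/-- **`λ_max(T1) ≤ 9N + 6` on the DQG-feasible set ALONE**, as `(9N+6) · 1 − t1Map γ Γ ⪰ 0`: the
quadratic-form estimate `IsDQGFeasible.re_quadForm_t1Map_le` (`D`, `Q`, `G` only) and the Hermiticity
`IsDQGFeasible.t1Map_isHermitian`; no `T1 ⪰ 0` hypothesis. So `9N + 6` is an admissible a-priori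
operator constant for the `T1` block — and, by the principal-submatrix / orbit-compression rules below,
for every sub-block or compacted block of it — in ANY program containing the `D`, `Q`, `G` conditions
(full `PQGT1…`, restricted `DQG + T1[e₁] + …`). SHARPENS the printed trace constant
`λmax(T1) ≤ (r−2)(r(r−1) − 3N(r−N))` of Chaykin et al. (2016) (4.6); proved here, not printed.
[cite: ChaykinEtAl2016RigorousESC, §4.1 eq. (4.6), p. 15] -/
theorem IsDQGFeasible.posSemidef_smul_one_sub_t1Map (h : IsDQGFeasible N γ Γ) :
    (((9 * N + 6 : ℕ) : ℂ) • (1 : Matrix (ι × ι × ι) (ι × ι × ι) ℂ) - t1Map γ Γ).PosSemidef := by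
  have hc : ((9 * N + 6 : ℕ) : ℂ) = (((9 * (N : ℝ) + 6 : ℝ)) : ℂ) := by push_cast; ring
  rw [hc]
  exact posSemidef_smul_one_sub_of_re_quadForm_le h.t1Map_isHermitian h.re_quadForm_t1Map_le

/-- **Any sub-block**: for every injective member list `e` of triples,
`(9N+6) · 1 − T1[e,e] ⪰ 0` on the DQG-feasible set (principal-submatrix rule, Horn–Johnson Obs. 7.1.2
[corpus `book:horn2012-matrix-analysis` p0527 L29]) — e.g. an orbital-subset ("active-space") block
`T1[A]` or one spin class of it, as a restricted three-index program writes it.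
[cite: HornJohnson2013, Obs. 7.1.2] -/
theorem IsDQGFeasible.posSemidef_smul_one_sub_t1Map_submatrix (h : IsDQGFeasible N γ Γ)
    {l : Type*} [DecidableEq l] {e : l → ι × ι × ι} (he : Function.Injective e) :
    (((9 * N + 6 : ℕ) : ℂ) • (1 : Matrix l l ℂ) - (t1Map γ Γ).submatrix e e).PosSemidef := by
  rw [← submatrix_smul_one_sub₃ _ _ he]
  exact h.posSemidef_smul_one_sub_t1Map.submatrix e

/-- **`x̄ = (9N+6)/6` for a representative block of `T1` on the DQG-feasible set ALONE**: for every
injective system of triples `e₀` no row of which is a proper rearrangement of another (the sorted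
triples; the rows `(xσ, yσ, zτ)`, `x < y`, of one spin class; …),
`((9N+6)/6) · 1 − T1[e₀,e₀] ⪰ 0` — the orbit-compression rule
`posSemidef_sixth_smul_one_sub_submatrix_of_triple` (the orbit partners live in the FULL `t1Map`, which
need not be a block of the program) fed with `IsDQGFeasible.posSemidef_smul_one_sub_t1Map` and
`IsDQGFeasible.t1Map_isHermitian`. ("We view `g` as a vector of dimension `\binom{r}{3}`",
Braams–Percus–Zhao §II eq. (3).) [cite: BraamsPercusZhao2007, §II eq. (3)] -/
theorem IsDQGFeasible.posSemidef_sixth_smul_one_sub_t1Map_submatrix (h : IsDQGFeasible N γ Γ)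
    {l : Type*} [Fintype l] [DecidableEq l] {e₀ : l → ι × ι × ι} (he₀ : Function.Injective e₀)
    (hf₂ : ∀ i j, e₀ i ≠ ((e₀ j).2.1, (e₀ j).1, (e₀ j).2.2))
    (hf₃ : ∀ i j, e₀ i ≠ ((e₀ j).1, (e₀ j).2.2, (e₀ j).2.1))
    (hf₄ : ∀ i j, e₀ i ≠ ((e₀ j).2.1, (e₀ j).2.2, (e₀ j).1))
    (hf₅ : ∀ i j, e₀ i ≠ ((e₀ j).2.2, (e₀ j).1, (e₀ j).2.1))
    (hf₆ : ∀ i j, e₀ i ≠ ((e₀ j).2.2, (e₀ j).2.1, (e₀ j).1)) :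
    ((((9 * N + 6 : ℕ) : ℂ) / 6) • (1 : Matrix l l ℂ) - (t1Map γ Γ).submatrix e₀ e₀).PosSemidef := by
  have hT : t1Map γ Γ = t1Antisymm γ Γ :=
    QuantumChemistry.t1Map_eq_t1Antisymm γ h.swap_fst h.swap_snd
  refine posSemidef_sixth_smul_one_sub_submatrix_of_triple _ h.t1Map_isHermitian
    h.posSemidef_smul_one_sub_t1Map (fun a b c' J => ?_) (fun a b c' J => ?_) he₀ hf₂ hf₃ hf₄ hf₅ hf₆
  · rw [hT]; exact t1Antisymm_swap₁₂_left γ Γ a b c' J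
  · rw [hT]; exact t1Antisymm_swap₂₃_left γ Γ a b c' J

omit [Fintype ι] in
/-- Strictly increasing triples meet every rearrangement orbit at most once (plumbing). [folklore] -/
private theorem orderedTriples_free₃ (i j : OrderedTriples ι) :
    i.val ≠ (j.val.2.1, j.val.1, j.val.2.2) ∧ i.val ≠ (j.val.1, j.val.2.2, j.val.2.1) ∧
      i.val ≠ (j.val.2.1, j.val.2.2, j.val.1) ∧ i.val ≠ (j.val.2.2, j.val.1, j.val.2.1) ∧
      i.val ≠ (j.val.2.2, j.val.2.1, j.val.1) := by
  obtain ⟨⟨x, y, z⟩, hxy, hyz⟩ := i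
  obtain ⟨⟨x', y', z'⟩, hxy', hyz'⟩ := j
  simp only [ne_eq, Prod.mk.injEq]
  refine ⟨?_, ?_, ?_, ?_, ?_⟩
  · rintro ⟨rfl, rfl, rfl⟩; exact lt_asymm hxy hxy'
  · rintro ⟨rfl, rfl, rfl⟩; exact lt_asymm hyz hyz'
  · rintro ⟨rfl, rfl, rfl⟩; exact lt_asymm (lt_trans hxy hyz) hxy'
  · rintro ⟨rfl, rfl, rfl⟩; exact lt_asymm hxy (lt_trans hxy' hyz')
  · rintro ⟨rfl, rfl, rfl⟩; exact lt_asymm (lt_trans hxy hyz) (lt_trans hxy' hyz')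

/-- **The `\binom{r}{3}`-row `T1` matrix on the DQG-feasible set ALONE**: `((9N+6)/6) · 1 − T1|_{ord} ⪰ 0`
(rows `i < j < k`, `OrderedTriples ι`). [cite: BraamsPercusZhao2007, §II eq. (3)] -/
theorem IsDQGFeasible.posSemidef_sixth_smul_one_sub_t1Map_orderedTriples (h : IsDQGFeasible N γ Γ) :
    ((((9 * N + 6 : ℕ) : ℂ) / 6) • (1 : Matrix (OrderedTriples ι) (OrderedTriples ι) ℂ) -
      (t1Map γ Γ).submatrix Subtype.val Subtype.val).PosSemidef :=
  h.posSemidef_sixth_smul_one_sub_t1Map_submatrix Subtype.val_injective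
    (fun i j => (orderedTriples_free₃ i j).1) (fun i j => (orderedTriples_free₃ i j).2.1)
    (fun i j => (orderedTriples_free₃ i j).2.2.1) (fun i j => (orderedTriples_free₃ i j).2.2.2.1)
    fun i j => (orderedTriples_free₃ i j).2.2.2.2

end Loewner

/-! ### §3 The same constants in the REAL programme (`hub` / `hXub` shapes) -/

section RealShapes

variable {ι : Type*} [LinearOrder ι] [Fintype ι] {N : ℕ} {γ : Matrix ι ι ℂ}
  {Γ : Matrix (ι × ι) (ι × ι) ℂ}

/-- `((9N+6 : ℕ) : ℝ) · 1 − Re T1 ⪰ 0` over `ℝ` on the DQG-feasible set.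
[cite: ChaykinEtAl2016RigorousESC, §4.1 eq. (4.6), p. 15] -/
theorem IsDQGFeasible.posSemidef_smul_one_sub_t1Map_re (h : IsDQGFeasible N γ Γ) :
    (((9 * N + 6 : ℕ) : ℝ) • (1 : Matrix (ι × ι × ι) (ι × ι × ι) ℝ) -
      (t1Map γ Γ).map Complex.re).PosSemidef := by
  have h1 := h.posSemidef_smul_one_sub_t1Map
  rw [show ((9 * N + 6 : ℕ) : ℂ) = ((((9 * N + 6 : ℕ) : ℝ)) : ℂ) by push_cast; ring] at h1
  exact posSemidef_smul_one_sub_map_re h1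

/-- `((9N+6 : ℕ) : ℝ) · 1 − Re T1[e,e] ⪰ 0` over `ℝ` for an injective member list, DQG set.
[cite: ChaykinEtAl2016RigorousESC, §4.1 eq. (4.6), p. 15] -/
theorem IsDQGFeasible.posSemidef_smul_one_sub_t1Map_submatrix_re (h : IsDQGFeasible N γ Γ)
    {l : Type*} [Fintype l] [DecidableEq l] {e : l → ι × ι × ι} (he : Function.Injective e) :
    (((9 * N + 6 : ℕ) : ℝ) • (1 : Matrix l l ℝ) -
      ((t1Map γ Γ).submatrix e e).map Complex.re).PosSemidef := by
  have h1 := h.posSemidef_smul_one_sub_t1Map_submatrix he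
  rw [show ((9 * N + 6 : ℕ) : ℂ) = ((((9 * N + 6 : ℕ) : ℝ)) : ℂ) by push_cast; ring] at h1
  exact posSemidef_smul_one_sub_map_re h1

/-- `((9N+6)/6 : ℝ) · 1 − Re T1|_{ord} ⪰ 0` over `ℝ` on the DQG-feasible set.
[cite: ChaykinEtAl2016RigorousESC, §4.1 eq. (4.6), p. 15] -/
theorem IsDQGFeasible.posSemidef_sixth_smul_one_sub_t1Map_orderedTriples_re (h : IsDQGFeasible N γ Γ) :
    ((((9 * N + 6 : ℕ) : ℝ) / 6) • (1 : Matrix (OrderedTriples ι) (OrderedTriples ι) ℝ) -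
      ((t1Map γ Γ).submatrix Subtype.val Subtype.val).map Complex.re).PosSemidef := by
  have h1 := h.posSemidef_sixth_smul_one_sub_t1Map_orderedTriples
  rw [show ((9 * N + 6 : ℕ) : ℂ) / 6 = ((((9 * N + 6 : ℕ) : ℝ) / 6 : ℝ) : ℂ) by push_cast; ring] at h1
  exact posSemidef_smul_one_sub_map_re h1

end RealShapes

end Literature.MathematicalPhysics.QuantumChemistry

end
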